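import Summits.HodgeConjecture.CorCM.CMFourfoldsOfMarkman
import Literature.AlgebraicGeometry.HodgeTheory.CodimTwoDivisorWeilGenerated
import Literature.AlgebraicGeometry.HodgeTheory.RibetTypeOnePowersHodgeClasses
import Literature.AlgebraicGeometry.HodgeTheory.QuaternionMinimalPowersHodgeClasses
import Literature.AlgebraicGeometry.HodgeTheory.QuarticCMTwoOnePowersHodgeClasses
import Literature.AlgebraicGeometry.Motives.AbelianVarietyIsogenyPairFlip
import HarnessLib

/-!
# Ring 2 (cell topic `Summits/HodgeConjecture/Ring2/`; seat `lit`, gen 64, programme R37): MOONEN–ZARHIN Thm. 0.1 IN CODIMENSION 2 — `B²(X) ⊆ D²(X) + Σ_K W_K` — FOR EVERY COMPLEX ABELIAN FOURFOLD OF CM TYPE AND FOR EVERY NON-SIMPLE FOURFOLD, UNCONDITIONALLY; the named fact `MoonenZarhin1999_codimTwoHodgeClasses_abelianFourfold` localised to the SIMPLE NON-CM fourfolds (Moonen–Zarhin 1995)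

HONEST FRAMING (cell `pub-hodge-ring2`, verbatim): research route conditional on HC_CM; not a corollary;
Q11.4-sentence-2 already refuted in dim ≥ 3. `HC_CM` does NOT occur in this file, nor does Markman's theorem: everything
below is an unconditional theorem of the tree. NEW as an assembly of the Literature lane's non-CM half with the CorCM
cell's CM calculus (hence under `Summits/`); theorems only — no definition, no named fact, no `sorry`.

THE PRINT. B. Moonen, Yu. Zarhin, *Hodge classes on abelian varieties of low dimension*, Math. Ann. **315** (1999)
711–733, Thm. 0.1 with (1.4), (1.9) — the tree's NAMED FACT `MoonenZarhin1999_codimTwoHodgeClasses_abelianFourfold`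
(`Literature/AlgebraicGeometry/HodgeTheory/AbelianLowDimensionCodimTwoHodgeClasses`): for every complex abelian
fourfold, every rational `(2,2)`-class lies in `D² ⊗ ℂ ⊔ span_ℂ {rational (2,2) Weil classes of (X, φ, d), φ ≫ φ = -d}`;
its pointwise form is the Literature predicate `IsCodimTwoDivisorWeilGenerated X`
(`HodgeTheory/CodimTwoDivisorWeilGenerated`, lit gen 64: `fact ↔ ∀ X, dim X = 4 → IsCodimTwoDivisorWeilGenerated X`,
`Iff.rfl`). §5 (5.1): «As recalled above we already know this in case `X` is simple [Moonen–Zarhin 1995]. In the rest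
of this section we may, and will, therefore assume that `X` is not simple. Up to isogeny we can decompose `X` …».

THE TWO HALVES, BY NAME.
* `X` OF CM TYPE (simple or not; includes case (a2) `E_k × T`, `T` a simple CM threefold with sextic CM field `⊇ k`) —
  the CorCM cell's `CMWeights.moonenZarhin_codimTwo_biproduct_cm` (`CorCM/CMProductFourfoldsOfMarkman`, §4: the
  conclusion of the fact at every biproduct `⨁_i A_i` of CM realisations with `dim = 4`, hypothesis-free, by Pohlmann's
  theorem and the dichotomy «divisor pairs or Weil section») carried to `X` along `X ∼ B ≼ ⨁_i C_i`
  (`Milne1999.hDecompPos_of_hSimplePos` at Riemann's theorem `deligneMilne1982_Thm_6_20_full_holds`,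
  `CMWeights.exists_biproduct_family_of_isProductOf`; a domination between abelian varieties of the same dimension is an
  isogeny, `AbelianVariety.isIsogeny_of_comp_eq_nsmul_id`) by the ISOGENY INVARIANCE of the predicate
  (`IsCodimTwoDivisorWeilGenerated.of_isIsogeny`, `.of_isIsogenous`, van Geemen 3.6–3.7).
* `X` NON-SIMPLE, NOT OF CM TYPE — the Literature lane's
  `isCodimTwoDivisorWeilGenerated_of_dim_eq_four_of_not_isSimple_of_not_isOfCMType` (Thm. 0.1 (4) outside case (a) via
  `isStablyNondegenerate_of_dim_eq_four_of_not_isSimple_of_not_isOfCMType'`; case (a1) via R30's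
  `isDivisorWeilGenerated_prod_cmCurve_of_unitaryTwoOne`).

RESULTS (`X : AbelianVariety ℂ`, `dim X = 4`):
**`isCodimTwoDivisorWeilGenerated_of_isOfCMType`** (every CM fourfold), **`isCodimTwoDivisorWeilGenerated_of_not_isSimple`**
(every non-simple fourfold) — both UNCONDITIONAL —; the LOCALISATION of the named fact:
**`moonenZarhin1999_codimTwoHodgeClasses_abelianFourfold_iff_isSimple_not_isOfCMType`** (the fact ↔ its instances at
the SIMPLE fourfolds NOT of CM type — Moonen–Zarhin 1995, Duke 77, cases (b), (c), (d), (4)) and, subtracting the two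
sub-rows of Moonen–Zarhin 1995 that are already unconditional `B = D` theorems of the tree — Ribet type `(3,1)`
(`AbelianVariety.isDivisorGenerated_of_ribetTypeOne`, Ribet 1983 Thm. 3) and minimal quaternion type
(`AbelianVariety.isDivisorGenerated_of_isSimple_quaternion_of_dim_eq`, Banaszak–Gajda–Krasoń 7.34) —,
**`moonenZarhin1999_codimTwoHodgeClasses_abelianFourfold_iff_residual`**. On path: the fact gives each instance
(`isCodimTwoDivisorWeilGenerated_of_dim_eq_four_of_fact`).  §5 subtracts the maximal real-multiplication sub-row
(`AbelianVariety.isDivisorGenerated_of_isTotallyReal`; `…_iff_residual'`), §6 the quartic-CM `{(1,1),(2,0)}` sub-row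
(`AbelianVariety.isDivisorGenerated_of_quarticCM`, Thm. 0.2 (4) via (2.4); `…_iff_residual''`).

WHAT IS NOT CLAIMED: the fact is NOT discharged (the simple non-CM fourfolds of types I(1), I(2), non-minimal
II, III, IV(1,1) of Weil type `(2,2)`, IV(2,1) `⊇ k` of signature `(2,2)`, IV with `d = 2` remain — Moonen–Zarhin 1995);
nothing on `B² ≠ D²`;
no Hodge-conjecture statement is made here (for HC from the predicate see the Literature file's
`IsCodimTwoDivisorWeilGenerated.hodgeConjectureFor_of_markman`, and `Ring2/LowDimensionHodgeOfMarkman*`).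

## References
* [MoonenZarhin1999LowDim] B. Moonen, Yu. Zarhin, Math. Ann. 315 (1999) 711–733, Thm. 0.1 with (1.4), (1.9), §5 (5.1),
  (5.3)–(5.5).
* [MoonenZarhin1995Duke] B. Moonen, Yu. Zarhin, Duke Math. J. 77 (1995) 553–581, Thm. 2.4 (simple fourfolds).
* [Pohlmann1968] H. Pohlmann, Ann. of Math. 88 (1968), Thm. 1.
* [MumfordAV1970] D. Mumford, *Abelian Varieties* (1970), §19 Thm. 1, Cor. 1 and Remark p. 169.
* [Shimura1998] G. Shimura, *Abelian Varieties with Complex Multiplication and Modular Functions*, §5.1 Props. 3–6, §7.1.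
* [vanGeemen1994HodgeAV] B. van Geemen, LNM 1594 (1994), 3.6–3.7.
* [Ribet1983] K. A. Ribet, Amer. J. Math. 105 (1983), Thm. 3.
* [BanaszakGajdaKrason2006] G. Banaszak, W. Gajda, P. Krasoń, J. Number Theory (2006), Thm. 7.34.
-/

noncomputable section

open CategoryTheory CategoryTheory.Limits NumberField

namespace Summit.HodgeConjecture.Ring2.NonSimpleFourfoldsCodimTwo

open Literature.AlgebraicGeometry.Motives (AbelianVariety)
open Literature.AlgebraicGeometry.Motives.AbelianVariety
open Literature.AlgebraicGeometry.HodgeTheory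
open Literature.AlgebraicGeometry.ComplexMultiplication (IsCMTypeRealisation)
open Literature.AlgebraicGeometry.Milne1999
open Literature.NumberTheory.Automorphic (IsQuaternionAlgebra)
open Summit.HodgeConjecture.CorCM.Domination
open Summit.HodgeConjecture.CorCM.CMWeights (exists_biproduct_family_of_isProductOf moonenZarhin_codimTwo_biproduct_cm)

variable {X : AbelianVariety ℂ}

/-! ### §1 Every complex abelian fourfold of CM type -/

/-- **MOONEN–ZARHIN Thm. 0.1 IN CODIMENSION 2 FOR EVERY COMPLEX ABELIAN FOURFOLD OF CM TYPE — UNCONDITIONAL: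
`B²(X) ⊆ D²(X) + Σ_K W_K`** (simple or not: the simple CM fourfolds, the CM members `E_k × T` of case (a) — (a2), `T`
simple with sextic CM field `⊇ k` —, products of CM surfaces and curves). `X` is isogenous to a product `B` of CM-typed
abelian varieties (Poincaré + Shimura, `hDecompPos_of_hSimplePos` at Riemann's theorem), `B` is dominated by — being of
the same dimension, isogenous to — a biproduct `⨁_i C_i` of CM realisations of total dimension `4`, where the CorCM
calculus proves the conclusion hypothesis-free (`moonenZarhin_codimTwo_biproduct_cm`); the predicate travels back along
the two isogenies (`IsCodimTwoDivisorWeilGenerated.of_isIsogeny`, `.of_isIsogenous`).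
[cite: MoonenZarhin1999LowDim, Thm. 0.1 with (1.4), (1.9) and §5 (5.1), (5.3), (5.5)] [cite: Pohlmann1968, Thm. 1]
[cite: MumfordAV1970, §19 Thm. 1 and Remark p. 169] [cite: Shimura1998, §5.1 Props. 3–6 and §7.1] -/
theorem isCodimTwoDivisorWeilGenerated_of_isOfCMType (hX4 : X.dim = 4) (hcm : IsOfCMType X) :
    IsCodimTwoDivisorWeilGenerated X := by
  obtain ⟨B, hB, hXB⟩ :=
    hDecompPos_of_hSimplePos (hSimplePos_of_riemann deligneMilne1982_Thm_6_20_full_holds) X (by omega) hcm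
  obtain ⟨n, K, iF, iN, iC, C, Φ, ι, θ, hC, hdom, hdim⟩ := exists_biproduct_family_of_isProductOf hB
  have hBdim : B.dim = 4 := by
    obtain ⟨g, hg⟩ := hXB
    rw [← dim_eq_of_isIsogeny hg, hX4]
  have hCdim : (⨁ C).dim = 4 := hdim.trans hBdim
  have hP : IsCodimTwoDivisorWeilGenerated (⨁ C) := fun c hc hH =>
    moonenZarhin_codimTwo_biproduct_cm hC hCdim c hc hH
  obtain ⟨s, π, N, hN, hsπ⟩ := hdom
  have hs : AbelianVariety.IsIsogeny s :=
    isIsogeny_of_comp_eq_nsmul_id (K := ℂ) (Nat.cast_ne_zero.2 hN) hsπ (hBdim.trans hCdim.symm)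
  exact (hP.of_isIsogeny hs).of_isIsogenous hXB

/-! ### §2 Every non-simple complex abelian fourfold -/

/-- **MOONEN–ZARHIN Thm. 0.1 IN CODIMENSION 2 FOR EVERY NON-SIMPLE COMPLEX ABELIAN FOURFOLD — UNCONDITIONAL:
`B²(X) ⊆ D²(X) + Σ_K W_K`.** `X` of CM type: §1; `X` not of CM type: the Literature theorem
`isCodimTwoDivisorWeilGenerated_of_dim_eq_four_of_not_isSimple_of_not_isOfCMType` (Thm. 0.1 (4) outside case (a),
(5.4); case (a1) `E_k × T`, `End⁰(T) = k`, by `B•(T × E_k) ⊆ D• + W_k`, (5.3)). This is the whole of §5 (5.1)–(5.5) of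
the print for fourfolds, read in codimension `2`. [cite: MoonenZarhin1999LowDim, Thm. 0.1 (1), (4) and §5 (5.1)–(5.5)]
[cite: MumfordAV1970, §19 Thm. 1 (pp. 173–174)] -/
theorem isCodimTwoDivisorWeilGenerated_of_not_isSimple (hX4 : X.dim = 4) (hX : ¬ X.IsSimple) :
    IsCodimTwoDivisorWeilGenerated X := by
  by_cases hcm : IsOfCMType X
  · exact isCodimTwoDivisorWeilGenerated_of_isOfCMType hX4 hcm
  · exact isCodimTwoDivisorWeilGenerated_of_dim_eq_four_of_not_isSimple_of_not_isOfCMType hX4 hX hcm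

/-- Every complex abelian fourfold that is non-simple OR of CM type satisfies `B² ⊆ D² + Σ_K W_K`, unconditionally.
[cite: MoonenZarhin1999LowDim, Thm. 0.1 and §5 (5.1)–(5.5)] -/
theorem isCodimTwoDivisorWeilGenerated_of_not_isSimple_or_isOfCMType (hX4 : X.dim = 4)
    (h : ¬ X.IsSimple ∨ IsOfCMType X) : IsCodimTwoDivisorWeilGenerated X :=
  h.elim (isCodimTwoDivisorWeilGenerated_of_not_isSimple hX4) (isCodimTwoDivisorWeilGenerated_of_isOfCMType hX4)

/-! ### §3 The named fact localised to the simple fourfolds not of CM type (Moonen–Zarhin 1995) -/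

/-- **LOCALISATION OF THE NAMED FACT.** `MoonenZarhin1999_codimTwoHodgeClasses_abelianFourfold` (Thm. 0.1 in
codimension `2` for ALL fourfolds) is EQUIVALENT to its instances at the SIMPLE complex abelian fourfolds NOT of CM type
— exactly the content of Moonen–Zarhin 1995 (Duke 77) that the tree has not proved («we already know this in case `X`
is simple»): the non-simple fourfolds (§2) and the CM fourfolds (§1) are theorems. [cite: MoonenZarhin1999LowDim, Thm. 0.1 and §5 (5.1)]
[cite: MoonenZarhin1995Duke, Thm. 2.4] -/
theorem moonenZarhin1999_codimTwoHodgeClasses_abelianFourfold_iff_isSimple_not_isOfCMType :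
    MoonenZarhin1999_codimTwoHodgeClasses_abelianFourfold ↔
      ∀ A : AbelianVariety ℂ, A.dim = 4 → A.IsSimple → ¬ IsOfCMType A → IsCodimTwoDivisorWeilGenerated A :=
  ⟨fun h A hA _ _ => h A hA, fun hS =>
    moonenZarhin1999_codimTwoHodgeClasses_abelianFourfold_of_isOfCMType_of_isSimple
      (fun _ hA hcm => isCodimTwoDivisorWeilGenerated_of_isOfCMType hA hcm) hS⟩

/-- **A simple fourfold of RIBET TYPE `(3,1)`** (`dim_ℚ End⁰(A) = 2`, `φ ≫ φ = -d` with an eigenvalue of multiplicity `1`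
on `H^{1,0}`) **has `B = D`** (Ribet 1983 Thm. 3, the tree's `AbelianVariety.isDivisorGenerated_of_ribetTypeOne`), hence
`B² ⊆ D² + Σ W_K`. [cite: Ribet1983, Thm. 3] [cite: MoonenZarhin1999LowDim, §2 (2.3) and Thm. 0.1] -/
theorem isCodimTwoDivisorWeilGenerated_of_ribetTypeOne {A : AbelianVariety ℂ} (hA4 : A.dim = 4) (φ : A ⟶ A) {d : ℕ}
    (hd : 0 < d) (hφ : φ ≫ φ = -(d • 𝟙 A)) (hE2 : Module.finrank ℚ A.endAlgebra = 2)
    (h1 : eigenMultiplicity A φ (Complex.I * (Real.sqrt d : ℂ)) = 1 ∨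
      eigenMultiplicity A φ (-(Complex.I * (Real.sqrt d : ℂ))) = 1) :
    IsCodimTwoDivisorWeilGenerated A :=
  (AbelianVariety.isDivisorGenerated_of_ribetTypeOne A φ hd hφ hE2 h1 (by omega)).isCodimTwoDivisorWeilGenerated

/-- **A simple fourfold of MINIMAL QUATERNION TYPE** (`End⁰(A)` a quaternion algebra over a totally real field `K`,
`dim A = 2[K:ℚ]`) **has `B = D`** (Banaszak–Gajda–Krasoń 7.34, the tree's
`AbelianVariety.isDivisorGenerated_of_isSimple_quaternion_of_dim_eq`), hence `B² ⊆ D² + Σ W_K`; the structure packaged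
as an existential over `K` and its instances (as in `Ring2/LowDimensionHodgeOfMarkmanRowFour`).
[cite: BanaszakGajdaKrason2006, Thm. 7.34] [cite: MoonenZarhin1999LowDim, Thm. 0.1] -/
theorem isCodimTwoDivisorWeilGenerated_of_isSimple_of_exists_quaternion {A : AbelianVariety ℂ} (hs : A.IsSimple)
    (hQ : ∃ (K : Type) (_ : Field K) (_ : NumberField K) (_ : IsTotallyReal K) (_ : Algebra K A.endAlgebra)
      (_ : IsScalarTower ℚ K A.endAlgebra) (_ : IsQuaternionAlgebra K A.endAlgebra), A.dim = 2 * Module.finrank ℚ K) :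
    IsCodimTwoDivisorWeilGenerated A := by
  obtain ⟨K, _, _, _, _, _, _, hdim⟩ := hQ
  exact (AbelianVariety.isDivisorGenerated_of_isSimple_quaternion_of_dim_eq hs hdim).isCodimTwoDivisorWeilGenerated

/-- **THE RESIDUAL OF THE NAMED FACT.** `MoonenZarhin1999_codimTwoHodgeClasses_abelianFourfold` is EQUIVALENT to
`B² ⊆ D² + Σ W_K` on the simple complex abelian fourfolds that are not of CM type, NOT of Ribet type `(3,1)` and NOT of
minimal quaternion type — the rest of Moonen–Zarhin 1995 (types I(1), I(2), I(4), non-minimal II, III, IV(1,1) of Weil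
type `(2,2)`, IV(2,1), IV with `d = 2`), the same residual class as the cell's row-`4` axis statement
`LowDimOfMarkman.hcAtDim_four_iff_of_markman'`. [cite: MoonenZarhin1999LowDim, Thm. 0.1 and §5 (5.1)]
[cite: MoonenZarhin1995Duke, Thm. 2.4] [cite: Ribet1983, Thm. 3] [cite: BanaszakGajdaKrason2006, Thm. 7.34] -/
theorem moonenZarhin1999_codimTwoHodgeClasses_abelianFourfold_iff_residual :
    MoonenZarhin1999_codimTwoHodgeClasses_abelianFourfold ↔
      ∀ A : AbelianVariety ℂ, A.dim = 4 → A.IsSimple → ¬ IsOfCMType A →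
        (¬ ∃ (φ : A ⟶ A) (d : ℕ), 0 < d ∧ φ ≫ φ = -(d • 𝟙 A) ∧ Module.finrank ℚ A.endAlgebra = 2 ∧
          (eigenMultiplicity A φ (Complex.I * (Real.sqrt d : ℂ)) = 1 ∨
            eigenMultiplicity A φ (-(Complex.I * (Real.sqrt d : ℂ))) = 1)) →
        (¬ ∃ (K : Type) (_ : Field K) (_ : NumberField K) (_ : IsTotallyReal K) (_ : Algebra K A.endAlgebra)
          (_ : IsScalarTower ℚ K A.endAlgebra) (_ : IsQuaternionAlgebra K A.endAlgebra),
            A.dim = 2 * Module.finrank ℚ K) →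
        IsCodimTwoDivisorWeilGenerated A := by
  rw [moonenZarhin1999_codimTwoHodgeClasses_abelianFourfold_iff_isSimple_not_isOfCMType]
  refine ⟨fun h A hA hs hcm _ _ => h A hA hs hcm, fun h A hA hs hcm => ?_⟩
  by_cases hR : ∃ (φ : A ⟶ A) (d : ℕ), 0 < d ∧ φ ≫ φ = -(d • 𝟙 A) ∧ Module.finrank ℚ A.endAlgebra = 2 ∧
      (eigenMultiplicity A φ (Complex.I * (Real.sqrt d : ℂ)) = 1 ∨
        eigenMultiplicity A φ (-(Complex.I * (Real.sqrt d : ℂ))) = 1)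
  · obtain ⟨φ, d, hd, hφ, hE2, h1⟩ := hR
    exact isCodimTwoDivisorWeilGenerated_of_ribetTypeOne hA φ hd hφ hE2 h1
  by_cases hQ : ∃ (K : Type) (_ : Field K) (_ : NumberField K) (_ : IsTotallyReal K) (_ : Algebra K A.endAlgebra)
      (_ : IsScalarTower ℚ K A.endAlgebra) (_ : IsQuaternionAlgebra K A.endAlgebra), A.dim = 2 * Module.finrank ℚ K
  · exact isCodimTwoDivisorWeilGenerated_of_isSimple_of_exists_quaternion hs hQ
  exact h A hA hs hcm hR hQ

/-! ### §4 On path -/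

/-- **On path**: the named fact, granted, gives every instance proved above (the instances are CASES of the fact; no
new target is introduced). [cite: MoonenZarhin1999LowDim, Thm. 0.1] -/
theorem isCodimTwoDivisorWeilGenerated_of_fact (h : MoonenZarhin1999_codimTwoHodgeClasses_abelianFourfold)
    (hX4 : X.dim = 4) : IsCodimTwoDivisorWeilGenerated X :=
  isCodimTwoDivisorWeilGenerated_of_dim_eq_four_of_fact h hX4

/-! ### §5 (lit g64, R37-B) A third unconditional sub-row: maximal real multiplication (type I(4)) -/

/-- **A fourfold whose endomorphism algebra is a TOTALLY REAL FIELD OF DEGREE `4 = dim A`** (Albert type I(4):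
real multiplication by a totally real quartic field, `End⁰(A) = F`) **has `B = D`** — Ribet 1983 Thm. 0–1 /
Tankeev («`Hg(A) = R_{F/ℚ} SL₂`»), the tree's UNCONDITIONAL `AbelianVariety.isDivisorGenerated_of_isTotallyReal` —,
hence `B² ⊆ D² + Σ W_K`. [cite: Ribet1983, Thm. 1 (p. 524)] [cite: MoonenZarhin1995Duke, Thm. 2.4]
[cite: MoonenZarhin1999LowDim, Thm. 0.1] -/
theorem isCodimTwoDivisorWeilGenerated_of_isTotallyReal {A : AbelianVariety ℂ} (hF : IsField A.endAlgebra)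
    [NumberField.IsTotallyReal (Literature.AlgebraicGeometry.ComplexMultiplication.EndField A hF)] (hdeg : Module.finrank ℚ A.endAlgebra = A.dim) :
    IsCodimTwoDivisorWeilGenerated A :=
  (AbelianVariety.isDivisorGenerated_of_isTotallyReal A hF hdeg).isCodimTwoDivisorWeilGenerated

/-- **THE RESIDUAL OF THE NAMED FACT, REFINED**: `MoonenZarhin1999_codimTwoHodgeClasses_abelianFourfold` is
EQUIVALENT to `B² ⊆ D² + Σ W_K` on the simple complex abelian fourfolds that are not of CM type, NOT of Ribet type
`(3,1)`, NOT of minimal quaternion type and NOT of maximal real-multiplication type (`End⁰(A)` a totally real field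
of degree `4`) — the rest of Moonen–Zarhin 1995: types I(1), I(2), non-minimal II, III, IV(1,1) of Weil type
`(2,2)`, IV(2,1), IV with `d = 2`. The three subtracted sub-rows are unconditional `B = D` theorems of the tree.
[cite: MoonenZarhin1999LowDim, Thm. 0.1 and §5 (5.1)] [cite: MoonenZarhin1995Duke, Thm. 2.4] [cite: Ribet1983, Thm. 1 and Thm. 3]
[cite: BanaszakGajdaKrason2006, Thm. 7.34] -/
theorem moonenZarhin1999_codimTwoHodgeClasses_abelianFourfold_iff_residual' :
    MoonenZarhin1999_codimTwoHodgeClasses_abelianFourfold ↔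
      ∀ A : AbelianVariety ℂ, A.dim = 4 → A.IsSimple → ¬ IsOfCMType A →
        (¬ ∃ (φ : A ⟶ A) (d : ℕ), 0 < d ∧ φ ≫ φ = -(d • 𝟙 A) ∧ Module.finrank ℚ A.endAlgebra = 2 ∧
          (eigenMultiplicity A φ (Complex.I * (Real.sqrt d : ℂ)) = 1 ∨
            eigenMultiplicity A φ (-(Complex.I * (Real.sqrt d : ℂ))) = 1)) →
        (¬ ∃ (K : Type) (_ : Field K) (_ : NumberField K) (_ : IsTotallyReal K) (_ : Algebra K A.endAlgebra)
          (_ : IsScalarTower ℚ K A.endAlgebra) (_ : IsQuaternionAlgebra K A.endAlgebra),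
            A.dim = 2 * Module.finrank ℚ K) →
        (¬ ∃ hF : IsField A.endAlgebra, NumberField.IsTotallyReal (Literature.AlgebraicGeometry.ComplexMultiplication.EndField A hF) ∧
          Module.finrank ℚ A.endAlgebra = A.dim) →
        IsCodimTwoDivisorWeilGenerated A := by
  rw [moonenZarhin1999_codimTwoHodgeClasses_abelianFourfold_iff_residual]
  refine ⟨fun h A hA hs hcm hR hQ _ => h A hA hs hcm hR hQ, fun h A hA hs hcm hR hQ => ?_⟩
  by_cases hT : ∃ hF : IsField A.endAlgebra, NumberField.IsTotallyReal (Literature.AlgebraicGeometry.ComplexMultiplication.EndField A hF) ∧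
      Module.finrank ℚ A.endAlgebra = A.dim
  · obtain ⟨hF, hT, hdeg⟩ := hT
    haveI := hT
    exact isCodimTwoDivisorWeilGenerated_of_isTotallyReal hF hdeg
  exact h A hA hs hcm hR hQ hT

/-! ### §6 (lit gen 64, R37-C) The quartic-CM `{(1,1),(2,0)}` sub-row of the residual -/

/-- **A simple fourfold of QUARTIC CM TYPE `{(1,1),(2,0)}`** (`dim_ℚ End⁰(A) = 4`, `φ ∈ End(A)` acting on `H^{1,0}`
with eigenvalues `μ₁, μ̄₁` of multiplicity `1` and `μ₂` of multiplicity `2`, the four numbers `μ₁, μ̄₁, μ₂, μ̄₂`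
pairwise distinct — Moonen–Zarhin's type IV(2,1) with `End⁰(A) ⊉` an imaginary quadratic `k` of signature `(2,2)`)
**has `B = D`** (the tree's `AbelianVariety.isDivisorGenerated_of_quarticCM`, Thm. 0.2 (4) via (2.4)), hence
`B² ⊆ D² + Σ W_K`. [cite: MoonenZarhin1999LowDim, Thm. 0.1, Thm. 0.2 (4) and §2 (2.4)] [cite: MoonenZarhin1995Duke, Thm. 2.4] -/
theorem isCodimTwoDivisorWeilGenerated_of_quarticCM {A : AbelianVariety ℂ} (hs : A.IsSimple) (hA4 : A.dim = 4)
    (φ : A ⟶ A) (hE4 : Module.finrank ℚ A.endAlgebra = 4) {μ₁ μ₂ : ℂ} (h11 : starRingEnd ℂ μ₁ ≠ μ₁)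
    (h22 : starRingEnd ℂ μ₂ ≠ μ₂) (h12 : μ₂ ≠ μ₁) (h12' : μ₂ ≠ starRingEnd ℂ μ₁)
    (h1 : eigenMultiplicity A φ μ₁ = 1) (h1' : eigenMultiplicity A φ (starRingEnd ℂ μ₁) = 1)
    (h2 : eigenMultiplicity A φ μ₂ = 2) : IsCodimTwoDivisorWeilGenerated A :=
  (AbelianVariety.isDivisorGenerated_of_quarticCM A hs φ hE4 h11 h22 h12 h12' h1 h1' h2 hA4).isCodimTwoDivisorWeilGenerated

/-- **THE RESIDUAL, THIRD REFINEMENT.** The named fact is EQUIVALENT to `B² ⊆ D² + Σ W_K` on the simple non-CM fourfolds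
NOT of Ribet type `(3,1)`, NOT of minimal quaternion type, NOT of maximal real-multiplication type and NOT of quartic CM
type `{(1,1),(2,0)}` — what is left of Moonen–Zarhin 1995: types I(1), I(2), II and III over `ℚ`, IV(1,1) of Weil type
`(2,2)`, IV(2,1) `⊇ k` of signature `(2,2)`, IV with `d = 2`. [cite: MoonenZarhin1999LowDim, Thm. 0.1, Thm. 0.2 (4) and §2 (2.2)–(2.4)]
[cite: MoonenZarhin1995Duke, Thm. 2.4] [cite: Ribet1983, Thm. 3] [cite: BanaszakGajdaKrason2006, Thm. 7.34] -/
theorem moonenZarhin1999_codimTwoHodgeClasses_abelianFourfold_iff_residual'' :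
    MoonenZarhin1999_codimTwoHodgeClasses_abelianFourfold ↔
      ∀ A : AbelianVariety ℂ, A.dim = 4 → A.IsSimple → ¬ IsOfCMType A →
        (¬ ∃ (φ : A ⟶ A) (d : ℕ), 0 < d ∧ φ ≫ φ = -(d • 𝟙 A) ∧ Module.finrank ℚ A.endAlgebra = 2 ∧
          (eigenMultiplicity A φ (Complex.I * (Real.sqrt d : ℂ)) = 1 ∨
            eigenMultiplicity A φ (-(Complex.I * (Real.sqrt d : ℂ))) = 1)) →
        (¬ ∃ (K : Type) (_ : Field K) (_ : NumberField K) (_ : IsTotallyReal K) (_ : Algebra K A.endAlgebra)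
          (_ : IsScalarTower ℚ K A.endAlgebra) (_ : IsQuaternionAlgebra K A.endAlgebra),
            A.dim = 2 * Module.finrank ℚ K) →
        (¬ ∃ hF : IsField A.endAlgebra, NumberField.IsTotallyReal (Literature.AlgebraicGeometry.ComplexMultiplication.EndField A hF) ∧
          Module.finrank ℚ A.endAlgebra = A.dim) →
        (¬ ∃ (φ : A ⟶ A) (μ₁ μ₂ : ℂ), Module.finrank ℚ A.endAlgebra = 4 ∧ starRingEnd ℂ μ₁ ≠ μ₁ ∧
          starRingEnd ℂ μ₂ ≠ μ₂ ∧ μ₂ ≠ μ₁ ∧ μ₂ ≠ starRingEnd ℂ μ₁ ∧ eigenMultiplicity A φ μ₁ = 1 ∧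
          eigenMultiplicity A φ (starRingEnd ℂ μ₁) = 1 ∧ eigenMultiplicity A φ μ₂ = 2) →
        IsCodimTwoDivisorWeilGenerated A := by
  rw [moonenZarhin1999_codimTwoHodgeClasses_abelianFourfold_iff_residual']
  refine ⟨fun h A hA hs hcm hR hQ hT _ => h A hA hs hcm hR hQ hT, fun h A hA hs hcm hR hQ hT => ?_⟩
  by_cases hC : ∃ (φ : A ⟶ A) (μ₁ μ₂ : ℂ), Module.finrank ℚ A.endAlgebra = 4 ∧ starRingEnd ℂ μ₁ ≠ μ₁ ∧
      starRingEnd ℂ μ₂ ≠ μ₂ ∧ μ₂ ≠ μ₁ ∧ μ₂ ≠ starRingEnd ℂ μ₁ ∧ eigenMultiplicity A φ μ₁ = 1 ∧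
      eigenMultiplicity A φ (starRingEnd ℂ μ₁) = 1 ∧ eigenMultiplicity A φ μ₂ = 2
  · obtain ⟨φ, μ₁, μ₂, hE4, h11, h22, h12, h12', h1, h1', h2⟩ := hC
    exact isCodimTwoDivisorWeilGenerated_of_quarticCM hs hA φ hE4 h11 h22 h12 h12' h1 h1' h2
  exact h A hA hs hcm hR hQ hT hC

end Summit.HodgeConjecture.Ring2.NonSimpleFourfoldsCodimTwo

end
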